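import Summits.Ventures.Crystal3D.Theorems.StickyWulffConstantPolycrystalWulffBoundAggCertCheckSoundB

/-!
# `PolycrystalWulffBound`, line `PolyDensity`: soundness of the certificate checker, part C (the tree) — `AggCert27_8` from any checked tree

Route `StickyWulffConstant` of the venture `Summits/Ventures/Crystal3D`, crux `PolycrystalWulffBound`
(item `stmt-Ventures-19482`), second prover lane (poly-p2, gen 7).  `checkTree_sound` (induction over the kd-tree: a chamber point of
the box lies in a checked leaf — `checkLeaf_sound` — or in a skipped box, which the exact test `skipOK` shows to miss
the chamber, or in one of the two halves) and `aggCert_of_checkTree : checkTree T rootBox = true → AggCert27_8`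
(the root box contains the chamber; the bounds of the primal variables by `E` come from the energy row and the
floors; then `aggCert_of_rows`).  With this file the discharge of CH-P3 is reduced to exhibiting ONE tree `T` with
`checkTree T rootBox = true` (next files: the data and its evaluation).
WHAT THIS IS NOT: the certificate itself; F-C1 not moved.
-/

noncomputable section

namespace Summit.Ventures.Crystal3D.Theorems

open Finset
open Summit.Ventures.Crystal3D.Cruxes.PolycrystalWulffBound.PolyDensity (AggCert27_8)
/-- A skipped box contains no chamber point. -/
theorem QBox.skipOK_sound (B : QBox) (h : B.skipOK = true) {x1 x2 x3 : ℝ}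
    (l1 : (B.a1 : ℝ) ≤ x1) (u1 : x1 ≤ B.b1) (l2 : (B.a2 : ℝ) ≤ x2) (u2 : x2 ≤ B.b2) (l3 : (B.a3 : ℝ) ≤ x3)
    (c32 : x3 ≤ x2) (c21 : x2 ≤ x1) (c1 : x1 ≤ 17 / 20) (ct : x1 + x2 + x3 ≤ 1) : False := by
  unfold QBox.skipOK at h
  simp only [Bool.or_eq_true, decide_eq_true_eq] at h
  have hm3 : ((max B.a1 (max B.a2 B.a3) : ℚ) : ℝ) ≤ x1 := by
    push_cast
    exact max_le l1 (max_le (le_trans l2 c21) (le_trans l3 (le_trans c32 c21)))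
  have hm2 : ((max B.a2 B.a3 : ℚ) : ℝ) ≤ x2 := by
    push_cast
    exact max_le l2 (le_trans l3 c32)
  rcases h with (((h | h) | h) | h) | h
  · have : (B.b1 : ℝ) < B.a2 := by exact_mod_cast h
    linarith
  · have : (B.b2 : ℝ) < B.a3 := by exact_mod_cast h
    linarith
  · have : (B.b1 : ℝ) < B.a3 := by exact_mod_cast h
    linarith
  · have : (1 : ℝ) < ((max B.a1 (max B.a2 B.a3) : ℚ) : ℝ) + ((max B.a2 B.a3 : ℚ) : ℝ) + B.a3 := by exact_mod_cast h
    linarith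
  · have h' : (((17 : ℚ) / 20 : ℚ) : ℝ) < ((max B.a1 (max B.a2 B.a3) : ℚ) : ℝ) := Rat.cast_lt.2 h
    have e : (((17 : ℚ) / 20 : ℚ) : ℝ) = (17 : ℝ) / 20 := by push_cast; ring
    linarith

/-- **Soundness of the tree checker.** -/
theorem checkTree_sound (T : CTree) : ∀ (B : QBox), checkTree T B = true →
    ∀ {x1 x2 x3 S κ E F1 F2 F3 FR Y1 Y2 Y3 YR A12 A13 A1R A23 A2R A3R ARR : ℝ},
    (B.a1 : ℝ) ≤ x1 → x1 ≤ B.b1 → (B.a2 : ℝ) ≤ x2 → x2 ≤ B.b2 → (B.a3 : ℝ) ≤ x3 → x3 ≤ B.b3 →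
    0 ≤ x3 → x3 ≤ x2 → x2 ≤ x1 → x1 ≤ 17 / 20 → x1 + x2 + x3 ≤ 1 →
    0 ≤ E → 0 ≤ F1 → 0 ≤ F2 → 0 ≤ F3 → 0 ≤ FR → 0 ≤ Y1 → 0 ≤ Y2 → 0 ≤ Y3 → 0 ≤ YR →
    0 ≤ A12 → 0 ≤ A13 → 0 ≤ A1R → 0 ≤ A23 → 0 ≤ A2R → 0 ≤ A3R → 0 ≤ ARR → 0 ≤ S → 0 ≤ κ →
    κ ≤ (47623 : ℝ) / 5000 →
    (1 - x1 - x2 - x3) ^ ((2 : ℝ) / 3) ≤ S →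
    (∀ c : ℝ, 0 ≤ c → c ^ 3 * x3 ≤ 1 → (1 - x1 - x2 - x3) * c ≤ S) →
    F1 ≤ E → F2 ≤ E → F3 ≤ E → FR ≤ E → Y1 ≤ 20000 / 34641 * E → Y2 ≤ 20000 / 34641 * E →
    Y3 ≤ 20000 / 34641 * E → YR ≤ 20000 / 34641 * E → A12 ≤ E → A13 ≤ E → A1R ≤ E → A23 ≤ E → A2R ≤ E →
    A3R ≤ E → ARR ≤ E →
    (∀ r : ℕ, r < 100 → (aggRow r).lhs.val x1 x2 x3 S κ ≤
      (aggRow r).rhs E F1 F2 F3 FR Y1 Y2 Y3 YR A12 A13 A1R A23 A2R A3R ARR) → κ ≤ E := by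
  induction T with
  | leaf ts =>
    intro B hB x1 x2 x3 S κ E F1 F2 F3 FR Y1 Y2 Y3 YR A12 A13 A1R A23 A2R A3R ARR l1 u1 l2 u2 l3 u3 h3 c32 c21 c1 ct
      hE hF1 hF2 hF3 hFR hY1 hY2 hY3 hYR hA12 hA13 hA1R hA23 hA2R hA3R hARR hS hκ0 hκ hS1 hS2 bF1 bF2 bF3 bFR bY1 bY2
      bY3 bYR bA12 bA13 bA1R bA23 bA2R bA3R bARR hrows
    exact checkLeaf_sound B ts hB l1 u1 l2 u2 l3 u3 (by linarith) (by linarith) h3 ct hE hF1 hF2 hF3 hFR hY1 hY2 hY3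
      hYR hA12 hA13 hA1R hA23 hA2R hA3R hARR hS hκ0 hκ hS1 hS2 bF1 bF2 bF3 bFR bY1 bY2 bY3 bYR bA12 bA13 bA1R bA23
      bA2R bA3R bARR hrows
  | skip =>
    intro B hB x1 x2 x3 S κ E F1 F2 F3 FR Y1 Y2 Y3 YR A12 A13 A1R A23 A2R A3R ARR l1 u1 l2 u2 l3 u3 h3 c32 c21 c1 ct
    intros
    exact (B.skipOK_sound hB l1 u1 l2 u2 l3 c32 c21 c1 ct).elim
  | split k l r ihl ihr =>
    intro B hB x1 x2 x3 S κ E F1 F2 F3 FR Y1 Y2 Y3 YR A12 A13 A1R A23 A2R A3R ARR l1 u1 l2 u2 l3 u3 h3 c32 c21 c1 ct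
      hE hF1 hF2 hF3 hFR hY1 hY2 hY3 hYR hA12 hA13 hA1R hA23 hA2R hA3R hARR hS hκ0 hκ hS1 hS2 bF1 bF2 bF3 bFR bY1 bY2
      bY3 bYR bA12 bA13 bA1R bA23 bA2R bA3R bARR hrows
    simp only [checkTree, Bool.and_eq_true] at hB
    obtain ⟨hl, hr⟩ := hB
    have H := fun (B' : QBox) (hB' : checkTree l B' = true) (l1 : (B'.a1 : ℝ) ≤ x1) (u1 : x1 ≤ B'.b1)
        (l2 : (B'.a2 : ℝ) ≤ x2) (u2 : x2 ≤ B'.b2) (l3 : (B'.a3 : ℝ) ≤ x3) (u3 : x3 ≤ B'.b3) =>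
      ihl B' hB' l1 u1 l2 u2 l3 u3 h3 c32 c21 c1 ct hE hF1 hF2 hF3 hFR hY1 hY2 hY3 hYR hA12 hA13 hA1R hA23 hA2R hA3R
        hARR hS hκ0 hκ hS1 hS2 bF1 bF2 bF3 bFR bY1 bY2 bY3 bYR bA12 bA13 bA1R bA23 bA2R bA3R bARR hrows
    have H' := fun (B' : QBox) (hB' : checkTree r B' = true) (l1 : (B'.a1 : ℝ) ≤ x1) (u1 : x1 ≤ B'.b1)
        (l2 : (B'.a2 : ℝ) ≤ x2) (u2 : x2 ≤ B'.b2) (l3 : (B'.a3 : ℝ) ≤ x3) (u3 : x3 ≤ B'.b3) =>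
      ihr B' hB' l1 u1 l2 u2 l3 u3 h3 c32 c21 c1 ct hE hF1 hF2 hF3 hFR hY1 hY2 hY3 hYR hA12 hA13 hA1R hA23 hA2R hA3R
        hARR hS hκ0 hκ hS1 hS2 bF1 bF2 bF3 bFR bY1 bY2 bY3 bYR bA12 bA13 bA1R bA23 bA2R bA3R bARR hrows
    match k with
    | 0 =>
      rcases le_total x1 (((B.a1 + B.b1) / 2 : ℚ) : ℝ) with hx | hx
      · exact H (B.lowerHalf 0) hl l1 (by simpa [QBox.lowerHalf] using hx) (by simpa [QBox.lowerHalf] using l2)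
          (by simpa [QBox.lowerHalf] using u2) (by simpa [QBox.lowerHalf] using l3) (by simpa [QBox.lowerHalf] using u3)
      · exact H' (B.upperHalf 0) hr (by simpa [QBox.upperHalf] using hx) (by simpa [QBox.upperHalf] using u1)
          (by simpa [QBox.upperHalf] using l2) (by simpa [QBox.upperHalf] using u2) (by simpa [QBox.upperHalf] using l3)
          (by simpa [QBox.upperHalf] using u3)
    | 1 =>
      rcases le_total x2 (((B.a2 + B.b2) / 2 : ℚ) : ℝ) with hx | hx
      · exact H (B.lowerHalf 1) hl (by simpa [QBox.lowerHalf] using l1) (by simpa [QBox.lowerHalf] using u1) (by simpa [QBox.lowerHalf] using l2)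
          (by simpa [QBox.lowerHalf] using hx) (by simpa [QBox.lowerHalf] using l3) (by simpa [QBox.lowerHalf] using u3)
      · exact H' (B.upperHalf 1) hr (by simpa [QBox.upperHalf] using l1) (by simpa [QBox.upperHalf] using u1)
          (by simpa [QBox.upperHalf] using hx) (by simpa [QBox.upperHalf] using u2) (by simpa [QBox.upperHalf] using l3)
          (by simpa [QBox.upperHalf] using u3)
    | k + 2 =>
      rcases le_total x3 (((B.a3 + B.b3) / 2 : ℚ) : ℝ) with hx | hx
      · exact H (B.lowerHalf (k + 2)) hl (by simpa [QBox.lowerHalf] using l1) (by simpa [QBox.lowerHalf] using u1)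
          (by simpa [QBox.lowerHalf] using l2) (by simpa [QBox.lowerHalf] using u2) (by simpa [QBox.lowerHalf] using l3)
          (by simpa [QBox.lowerHalf] using hx)
      · exact H' (B.upperHalf (k + 2)) hr (by simpa [QBox.upperHalf] using l1) (by simpa [QBox.upperHalf] using u1)
          (by simpa [QBox.upperHalf] using l2) (by simpa [QBox.upperHalf] using u2) (by simpa [QBox.upperHalf] using hx)
          (by simpa [QBox.upperHalf] using u3)

/-- **`AggCert27_8` from a checked certificate tree.** -/
theorem aggCert_of_checkTree (T : CTree) (hT : checkTree T rootBox = true) : AggCert27_8 := by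
  refine aggCert_of_rows ?_
  intro x1 x2 x3 S κ E F1 F2 F3 FR Y1 Y2 Y3 YR A12 A13 A1R A23 A2R A3R ARR h1 h2 h3 h4 h5 hE hF1 hF2 hF3 hFR hY1 hY2
    hY3 hYR hA12 hA13 hA1R hA23 hA2R hA3R hARR hS hκ0 hκ hS1 hS2 hrows
  -- bounds of the primal variables by `E` from the energy row and the floors
  have r0 := hrows 0 (by norm_num)
  have r1 := hrows 1 (by norm_num)
  have r2 := hrows 2 (by norm_num)
  have r3 := hrows 3 (by norm_num)
  have r4 := hrows 4 (by norm_num)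
  simp only [aggRow, AggLhs.val, AggRow.rhs] at r0 r1 r2 r3 r4
  push_cast at r0 r1 r2 r3 r4
  refine checkTree_sound T rootBox hT (x1 := x1) (x2 := x2) (x3 := x3) (by simp [rootBox]; linarith)
    (by simp [rootBox]; linarith) (by simp [rootBox]; linarith) (by simp [rootBox]; linarith) (by simp [rootBox]; linarith)
    (by simp [rootBox]; linarith)
    h1 h2 h3 h4 h5 hE hF1 hF2 hF3 hFR hY1 hY2 hY3 hYR hA12 hA13 hA1R hA23 hA2R hA3R hARR hS hκ0 hκ hS1 hS2
    (by linarith) (by linarith) (by linarith) (by linarith) (by linarith) (by linarith) (by linarith) (by linarith)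
    (by linarith) (by linarith) (by linarith) (by linarith) (by linarith) (by linarith) (by linarith) hrows

end Summit.Ventures.Crystal3D.Theorems

end
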